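import Summits.CriticalPhenomena.PercolationContinuityZ3.Theorems.PercNearOneGluingNoHeavyLowerTailSahiMixtureFourRefutation

/-!
# The TOP cell of the mixture programme in DEFECT FORM: OR-ing an independent coin into ALL members of a triple / quadruple is Bernstein-positive
# as soon as the single top row `E_3(A) ≥ 0` / `E_4(A) ≥ 0` holds — explicit manifestly nonnegative pieces, no certificate

Support file of the one-cut programme (crux `NoHeavyLowerTail`, stmt-CriticalPhenomena-4575; cell `prim-masterthm`, seat P3, gen 6;
`run/shared/lean/prim/prim-masterthm/prim-masterthm-p3/HIERARCHY.md` §13(e)).  Vocabulary of `…SahiMixtureLaw` (`coinWeight`, `orCoin`, `BernsteinPos`).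

THE DEFECT FORM (this seat).  With `D_B = μ(⋃_{i∈B} Ā_i) = 1 − μ(⋂_{i∈B} A_i)` and `a_σ(λ) = Σ_{π ∈ Part(σ)} λ^{|π|} Π_{B∈π} (|B|−1)!·D_B`, Sahi's functional is
`E_m(A) = Σ_i a_{[m]∖i}(1) − a_{[m]}(1)`, and OR-ing an independent coin `H` of bias `h = 1 − λ` into EVERY member scales all defects by `λ`:
`T(λ) := E_m(A_1∪H,…,A_m∪H) = Σ_i a_{[m]∖i}(λ) − a_{[m]}(λ) = Σ_k λ^k T^{(k)}` (k = number of blocks).  Regrouping,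
  `T(λ) = λ(1−λ)·T^{(1)} + λ²·E_m(A) + Σ_{k≥3} (λ² − λ^k)·(−T^{(k)})`,   `T^{(1)} = (m−2)!·μ(|C| ≤ m−2)`,   `−T^{(m)} = Π_i μ(Ā_i)`,
and for `m ≤ 5` every `−T^{(k)}`, `k ≥ 3`, is a polynomial with nonnegative coefficients in the atoms (exact check, this seat; for `m = 4`:
`−T^{(3)} = ½ Σ_l Π_{r≠l} μ(Ā_r) + ½ Σ_{i≠l} μ(A_i ∖ A_l) Π_{r∉{i,l}} μ(Ā_r)`).  Hence:
* `sahiE_three_orCoin_top_eq`, **`bernsteinPos_three_orCoin_top`**: `E_3(A_0∪H,A_1∪H,A_2∪H) = h(1−h)·μ(|C|≤1) + (1−h)²·E_3(A) + h(1−h)²·Π_iμ(Ā_i)` —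
  Bernstein-positive of degree 3 as soon as `E_3(A) ≥ 0` (the gen-5 three-event theorem needed the whole of `K_3`).
* `sahiE_four_orCoin_top_eq`, **`bernsteinPos_four_orCoin_top`**: the analogous four-term identity at `m = 4`; Bernstein-positive of degree 4 as soon as
  `E_4(A) ≥ 0` — ttrl cp-mix's TOP(4) certificate ("c_j − C(2,j)E_4 has nonnegative coefficients", MIXCOMB §7.0) EXPLAINED: the multiple `C(m−2,j)` is
  the one that cancels the `T^{(2)}` term, `N_j = C(m−2,j−1)T^{(1)} + Σ_{k≥3}[C(m−2,j) − C(m−k,j)](−T^{(k)})`.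
CAVEAT recorded in HIERARCHY §13(e): `−T^{(3)}` acquires negative coefficients from `m = 9` on (`c(m−1,2) − c(m−1,3) < 0`, Stirling numbers), so this
coefficientwise route is NOT uniform in `m`; the conjectured uniform statement is the nonnegativity of the partial sums `Σ_{k≤j} T^{(k)}` on `K_m`
(CONJECTURE P; numerically clean for exchangeable laws to `m = 12`).  HONEST FRAMING: theorems for `m = 3, 4` only. [this work]
-/

noncomputable section

open scoped Classical

namespace Summit.CriticalPhenomena.PercolationContinuityZ3.Theorems

open Finset Function
open Literature.Combinatorics.Sahi2008
open Literature.Probability.Percolation.BHK2006 (ind_le_one)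
open Literature.Probability.Percolation.DecisionTree (ind ind_of_mem ind_of_not_mem ind_nonneg)

namespace SahiMixture

section Top

variable {α : Type*} [Fintype α] {μ : α → ℝ} (hμ : ∀ a, 0 ≤ μ a) (hμ1 : ∑ a, μ a = 1) (A0 A1 A2 A3 : Set α)

include hμ hμ1 in
/-- A defect `1 − μ(X)` is nonnegative. [folklore] -/
theorem one_sub_ex_ind_nonneg (X : Set α) : 0 ≤ 1 - ex μ (ind X) :=
  sub_nonneg.2 ((ex_mono hμ fun a => ind_le_one X a).trans_eq (ex_one hμ1))

include hμ in
/-- `μ(X ∖ Y) = μ(X) − μ(X ∩ Y) ≥ 0`, left factor kept. [folklore] -/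
theorem ex_ind_sub_ex_mul_nonneg_left (X Y : Set α) : 0 ≤ ex μ (ind X) - ex μ (ind X * ind Y) :=
  sub_nonneg.2 (ex_mono hμ fun a => by
    simp only [Pi.mul_apply]
    exact mul_le_of_le_one_right (ind_nonneg X a) (ind_le_one Y a))

include hμ in
/-- `μ(Y ∖ X) = μ(Y) − μ(X ∩ Y) ≥ 0`, right factor kept. [folklore] -/
theorem ex_ind_sub_ex_mul_nonneg_right (X Y : Set α) : 0 ≤ ex μ (ind Y) - ex μ (ind X * ind Y) :=
  sub_nonneg.2 (ex_mono hμ fun a => by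
    simp only [Pi.mul_apply]
    exact mul_le_of_le_one_left (ind_nonneg Y a) (ind_le_one X a))

/-! ### Three events -/

include hμ1 in
/-- **TOP(3) in defect form**: `E_3(A_0∪H, A_1∪H, A_2∪H) = h(1−h)·[1 − (E ab + E ac + E bc) + 2·E abc] + (1−h)²·E_3(A) + h(1−h)²·(1−E a)(1−E b)(1−E c)`
(the bracket is `μ(|C| ≤ 1)`). [this work] -/
theorem sahiE_three_orCoin_top_eq (h : ℝ) :
    sahiE (coinWeight μ h) 3 ![ind (orCoin A0 true), ind (orCoin A1 true), ind (orCoin A2 true)]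
      = h * (1 - h) * (1 - (ex μ (ind A0 * ind A1) + ex μ (ind A0 * ind A2) + ex μ (ind A1 * ind A2)) + 2 * ex μ (ind A0 * ind A1 * ind A2))
        + (1 - h) ^ 2 * sahiE μ 3 ![ind A0, ind A1, ind A2]
        + h * (1 - h) ^ 2 * ((1 - ex μ (ind A0)) * (1 - ex μ (ind A1)) * (1 - ex μ (ind A2))) := by
  rw [sahiE_three, sahiE_three]
  simp only [exc_or₃, exc_or₂, exc_or₁ μ h hμ1, cond_true, mul_one, ex_one hμ1]
  ring

include hμ hμ1 in
/-- **TOP(3) from the top row alone**: if `E_3(A_0,A_1,A_2) ≥ 0` then `h ↦ E_3(A_0∪H, A_1∪H, A_2∪H)` is Bernstein-positive of degree `3`. [this work] -/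
theorem bernsteinPos_three_orCoin_top (hE3 : 0 ≤ sahiE μ 3 ![ind A0, ind A1, ind A2]) :
    BernsteinPos 3 (fun h => sahiE (coinWeight μ h) 3 ![ind (orCoin A0 true), ind (orCoin A1 true), ind (orCoin A2 true)]) := by
  have hT1 : 0 ≤ 1 - (ex μ (ind A0 * ind A1) + ex μ (ind A0 * ind A2) + ex μ (ind A1 * ind A2)) + 2 * ex μ (ind A0 * ind A1 * ind A2) := by
    have hg : ∀ a, 0 ≤ 1 - (ind A0 a * ind A1 a + ind A0 a * ind A2 a + ind A1 a * ind A2 a) + 2 * (ind A0 a * ind A1 a * ind A2 a) := fun a => by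
      by_cases h0 : a ∈ A0 <;> by_cases h1 : a ∈ A1 <;> by_cases h2 : a ∈ A2 <;> norm_num [ind_of_mem, ind_of_not_mem, h0, h1, h2]
    have e := ex_eq_lin μ (fun a => 1 - (ind A0 a * ind A1 a + ind A0 a * ind A2 a + ind A1 a * ind A2 a) + 2 * (ind A0 a * ind A1 a * ind A2 a))
      ![1, -1, -1, -1, 2] ![fun _ => 1, ind A0 * ind A1, ind A0 * ind A2, ind A1 * ind A2, ind A0 * ind A1 * ind A2]
      (fun a => by simp [Fin.sum_univ_succ]; ring)
    simp only [Fin.sum_univ_succ, Fin.sum_univ_zero, Matrix.cons_val_zero, Matrix.cons_val_succ, ex_const hμ1] at e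
    have h0 := ex_nonneg hμ hg
    linarith
  have hN3 : 0 ≤ (1 - ex μ (ind A0)) * (1 - ex μ (ind A1)) * (1 - ex μ (ind A2)) :=
    mul_nonneg (mul_nonneg (one_sub_ex_ind_nonneg hμ hμ1 A0) (one_sub_ex_ind_nonneg hμ hμ1 A1)) (one_sub_ex_ind_nonneg hμ hμ1 A2)
  refine ((((bp_hg.smul hT1).mono (by norm_num : 2 ≤ 3)).add ((bp_g2.smul hE3).mono (by norm_num : 2 ≤ 3))).add (bp_hg2.smul hN3)).congr
    fun h _ _ => ?_
  rw [sahiE_three_orCoin_top_eq hμ1 A0 A1 A2 h]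
  ring

/-! ### Four events -/

include hμ1 in
/-- **TOP(4) in defect form**: `E_4(A_0∪H,…,A_3∪H) = h(1−h)·T₁ + (1−h)²·E_4(A) + h(1−h)²·N₃ + h(1−h)²(2−h)·N₄` with
`T₁ = 2[1 − Σ_i E(Π_{l≠i} x_l) + 3 E(abcd)] = 2μ(|C| ≤ 2)`, `N₃ = ½Σ_l Π_{r≠l}(1−E x_r) + ½Σ_{i≠l}(E x_i − E x_i x_l)Π_{r∉{i,l}}(1−E x_r)`, `N₄ = Π_i (1−E x_i)`.
[this work] -/
theorem sahiE_four_orCoin_top_eq (h : ℝ) :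
    sahiE (coinWeight μ h) 4 ![ind (orCoin A0 true), ind (orCoin A1 true), ind (orCoin A2 true), ind (orCoin A3 true)]
      = h * (1 - h) * (2 * (1 - (ex μ (ind A1 * ind A2 * ind A3) + ex μ (ind A0 * ind A2 * ind A3) + ex μ (ind A0 * ind A1 * ind A3)
            + ex μ (ind A0 * ind A1 * ind A2)) + 3 * ex μ (ind A0 * ind A1 * ind A2 * ind A3)))
        + (1 - h) ^ 2 * sahiE μ 4 ![ind A0, ind A1, ind A2, ind A3]
        + h * (1 - h) ^ 2 *
          ((1 / 2) * ((1 - ex μ (ind A1)) * (1 - ex μ (ind A2)) * (1 - ex μ (ind A3)) + (1 - ex μ (ind A0)) * (1 - ex μ (ind A2)) * (1 - ex μ (ind A3))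
              + (1 - ex μ (ind A0)) * (1 - ex μ (ind A1)) * (1 - ex μ (ind A3)) + (1 - ex μ (ind A0)) * (1 - ex μ (ind A1)) * (1 - ex μ (ind A2)))
          + (1 / 2) * ((ex μ (ind A0) - ex μ (ind A0 * ind A1)) * (1 - ex μ (ind A2)) * (1 - ex μ (ind A3))
              + (ex μ (ind A1) - ex μ (ind A0 * ind A1)) * (1 - ex μ (ind A2)) * (1 - ex μ (ind A3))
              + (ex μ (ind A0) - ex μ (ind A0 * ind A2)) * (1 - ex μ (ind A1)) * (1 - ex μ (ind A3))
              + (ex μ (ind A2) - ex μ (ind A0 * ind A2)) * (1 - ex μ (ind A1)) * (1 - ex μ (ind A3))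
              + (ex μ (ind A0) - ex μ (ind A0 * ind A3)) * (1 - ex μ (ind A1)) * (1 - ex μ (ind A2))
              + (ex μ (ind A3) - ex μ (ind A0 * ind A3)) * (1 - ex μ (ind A1)) * (1 - ex μ (ind A2))
              + (ex μ (ind A1) - ex μ (ind A1 * ind A2)) * (1 - ex μ (ind A0)) * (1 - ex μ (ind A3))
              + (ex μ (ind A2) - ex μ (ind A1 * ind A2)) * (1 - ex μ (ind A0)) * (1 - ex μ (ind A3))
              + (ex μ (ind A1) - ex μ (ind A1 * ind A3)) * (1 - ex μ (ind A0)) * (1 - ex μ (ind A2))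
              + (ex μ (ind A3) - ex μ (ind A1 * ind A3)) * (1 - ex μ (ind A0)) * (1 - ex μ (ind A2))
              + (ex μ (ind A2) - ex μ (ind A2 * ind A3)) * (1 - ex μ (ind A0)) * (1 - ex μ (ind A1))
              + (ex μ (ind A3) - ex μ (ind A2 * ind A3)) * (1 - ex μ (ind A0)) * (1 - ex μ (ind A1))))
        + h * (1 - h) ^ 2 * (2 - h) * ((1 - ex μ (ind A0)) * (1 - ex μ (ind A1)) * (1 - ex μ (ind A2)) * (1 - ex μ (ind A3))) := by
  rw [sahiE_four, sahiE_four]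
  simp only [exc_or₄, exc_or₃, exc_or₂, exc_or₁ μ h hμ1, cond_true, mul_one, ex_one hμ1]
  ring

include hμ hμ1 in
/-- **TOP(4) from the top row alone**: if `E_4(A_0,…,A_3) ≥ 0` then `h ↦ E_4(A_0∪H,…,A_3∪H)` is Bernstein-positive of degree `4` (every other piece of
the defect form is a product of probabilities).  In particular on `K_4` the all-members OR-mixture cell holds (ttrl cp-mix's coefficientwise certificate,
now a structural identity). [this work] -/
theorem bernsteinPos_four_orCoin_top (hE4 : 0 ≤ sahiE μ 4 ![ind A0, ind A1, ind A2, ind A3]) :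
    BernsteinPos 4 (fun h => sahiE (coinWeight μ h) 4
      ![ind (orCoin A0 true), ind (orCoin A1 true), ind (orCoin A2 true), ind (orCoin A3 true)]) := by
  -- the pieces are nonnegative
  have hT1 : 0 ≤ 2 * (1 - (ex μ (ind A1 * ind A2 * ind A3) + ex μ (ind A0 * ind A2 * ind A3) + ex μ (ind A0 * ind A1 * ind A3)
      + ex μ (ind A0 * ind A1 * ind A2)) + 3 * ex μ (ind A0 * ind A1 * ind A2 * ind A3)) := by
    have hg : ∀ a, 0 ≤ 1 - (ind A1 a * ind A2 a * ind A3 a + ind A0 a * ind A2 a * ind A3 a + ind A0 a * ind A1 a * ind A3 a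
        + ind A0 a * ind A1 a * ind A2 a) + 3 * (ind A0 a * ind A1 a * ind A2 a * ind A3 a) := fun a => by
      by_cases h0 : a ∈ A0 <;> by_cases h1 : a ∈ A1 <;> by_cases h2 : a ∈ A2 <;> by_cases h3 : a ∈ A3 <;>
        norm_num [ind_of_mem, ind_of_not_mem, h0, h1, h2, h3]
    have e := ex_eq_lin μ (fun a => 1 - (ind A1 a * ind A2 a * ind A3 a + ind A0 a * ind A2 a * ind A3 a + ind A0 a * ind A1 a * ind A3 a
        + ind A0 a * ind A1 a * ind A2 a) + 3 * (ind A0 a * ind A1 a * ind A2 a * ind A3 a))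
      ![1, -1, -1, -1, -1, 3]
      ![fun _ => 1, ind A1 * ind A2 * ind A3, ind A0 * ind A2 * ind A3, ind A0 * ind A1 * ind A3, ind A0 * ind A1 * ind A2,
        ind A0 * ind A1 * ind A2 * ind A3]
      (fun a => by simp [Fin.sum_univ_succ]; ring)
    simp only [Fin.sum_univ_succ, Fin.sum_univ_zero, Matrix.cons_val_zero, Matrix.cons_val_succ, ex_const hμ1] at e
    have h0 := ex_nonneg hμ hg
    linarith
  have d0 := one_sub_ex_ind_nonneg hμ hμ1 A0
  have d1 := one_sub_ex_ind_nonneg hμ hμ1 A1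
  have d2 := one_sub_ex_ind_nonneg hμ hμ1 A2
  have d3 := one_sub_ex_ind_nonneg hμ hμ1 A3
  have l01 := ex_ind_sub_ex_mul_nonneg_left hμ A0 A1
  have r01 := ex_ind_sub_ex_mul_nonneg_right hμ A0 A1
  have l02 := ex_ind_sub_ex_mul_nonneg_left hμ A0 A2
  have r02 := ex_ind_sub_ex_mul_nonneg_right hμ A0 A2
  have l03 := ex_ind_sub_ex_mul_nonneg_left hμ A0 A3
  have r03 := ex_ind_sub_ex_mul_nonneg_right hμ A0 A3
  have l12 := ex_ind_sub_ex_mul_nonneg_left hμ A1 A2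
  have r12 := ex_ind_sub_ex_mul_nonneg_right hμ A1 A2
  have l13 := ex_ind_sub_ex_mul_nonneg_left hμ A1 A3
  have r13 := ex_ind_sub_ex_mul_nonneg_right hμ A1 A3
  have l23 := ex_ind_sub_ex_mul_nonneg_left hμ A2 A3
  have r23 := ex_ind_sub_ex_mul_nonneg_right hμ A2 A3
  have hN3 : 0 ≤ (1 / 2) * ((1 - ex μ (ind A1)) * (1 - ex μ (ind A2)) * (1 - ex μ (ind A3)) + (1 - ex μ (ind A0)) * (1 - ex μ (ind A2)) * (1 - ex μ (ind A3))
              + (1 - ex μ (ind A0)) * (1 - ex μ (ind A1)) * (1 - ex μ (ind A3)) + (1 - ex μ (ind A0)) * (1 - ex μ (ind A1)) * (1 - ex μ (ind A2)))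
          + (1 / 2) * ((ex μ (ind A0) - ex μ (ind A0 * ind A1)) * (1 - ex μ (ind A2)) * (1 - ex μ (ind A3))
              + (ex μ (ind A1) - ex μ (ind A0 * ind A1)) * (1 - ex μ (ind A2)) * (1 - ex μ (ind A3))
              + (ex μ (ind A0) - ex μ (ind A0 * ind A2)) * (1 - ex μ (ind A1)) * (1 - ex μ (ind A3))
              + (ex μ (ind A2) - ex μ (ind A0 * ind A2)) * (1 - ex μ (ind A1)) * (1 - ex μ (ind A3))
              + (ex μ (ind A0) - ex μ (ind A0 * ind A3)) * (1 - ex μ (ind A1)) * (1 - ex μ (ind A2))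
              + (ex μ (ind A3) - ex μ (ind A0 * ind A3)) * (1 - ex μ (ind A1)) * (1 - ex μ (ind A2))
              + (ex μ (ind A1) - ex μ (ind A1 * ind A2)) * (1 - ex μ (ind A0)) * (1 - ex μ (ind A3))
              + (ex μ (ind A2) - ex μ (ind A1 * ind A2)) * (1 - ex μ (ind A0)) * (1 - ex μ (ind A3))
              + (ex μ (ind A1) - ex μ (ind A1 * ind A3)) * (1 - ex μ (ind A0)) * (1 - ex μ (ind A2))
              + (ex μ (ind A3) - ex μ (ind A1 * ind A3)) * (1 - ex μ (ind A0)) * (1 - ex μ (ind A2))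
              + (ex μ (ind A2) - ex μ (ind A2 * ind A3)) * (1 - ex μ (ind A0)) * (1 - ex μ (ind A1))
              + (ex μ (ind A3) - ex μ (ind A2 * ind A3)) * (1 - ex μ (ind A0)) * (1 - ex μ (ind A1))) := by
    positivity
  have hN4 : 0 ≤ (1 - ex μ (ind A0)) * (1 - ex μ (ind A1)) * (1 - ex μ (ind A2)) * (1 - ex μ (ind A3)) := by positivity
  -- Bernstein pieces: h(1−h), (1−h)², h(1−h)², h(1−h)²(2−h)
  have bp4 : BernsteinPos 4 (fun h : ℝ => h * (1 - h) ^ 2 * ((1 - h) * 2 + h * 1)) :=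
    bp_hg2.mul (bernsteinPos_affine (show (0:ℝ) ≤ 2 by norm_num) (show (0:ℝ) ≤ 1 by norm_num))
  refine (((((bp_hg.smul hT1).mono (by norm_num : 2 ≤ 4)).add ((bp_g2.smul hE4).mono (by norm_num : 2 ≤ 4))).add
    ((bp_hg2.smul hN3).mono (by norm_num : 3 ≤ 4))).add (bp4.smul hN4)).congr fun h _ _ => ?_
  rw [sahiE_four_orCoin_top_eq hμ1 A0 A1 A2 A3 h]
  ring

end Top

end SahiMixture

end Summit.CriticalPhenomena.PercolationContinuityZ3.Theorems

end
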